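import Literature.FieldTheory.AlgClosed.AutComplexClosedSubgroups
import Literature.FieldTheory.AlgClosed.AutComplexFiniteIndex
import HarnessLib

/-!
# `Aut(ℂ/⋂ᵢ Eᵢ)` is generated by the `Aut(ℂ/Eᵢ)`, `Eᵢ ⊂ ℂ` number fields

Topic `FieldTheory/AlgClosed`; theorems only (no definitions, no named facts), a sequel of
`AutComplexClosedSubgroups.lean` (`Complex.mem_subgroup_of_fix_fixedField`: a subgroup of `Aut(ℂ) = (ℂ ≃ₐ[ℚ] ℂ)`
containing some `Aut(ℂ/E₀)`, `E₀` a number field, contains every automorphism fixing its fixed field) and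
`AutComplexFiniteIndex.lean` (`Complex.mem_of_forall_mem_fixingSubgroup`: `Fix(Aut(ℂ/E)) = E` for `E` a number field).

For a family of subfields `Eᵢ ⊆ ℂ` finite over `ℚ` — e.g. the reflex fields `E(Φ)` of the CM types adapted to a fixed
embedding, whose intersection `E∩ = ⋂_Φ E(Φ)` is the candidate field of definition in Deligne's descent of canonical models
below the reflex field ([Deligne1971] Prop. 5.10: a model over `E∩` is a compatible system of models over the `Eᵢ`;
[Lang2002] Ch. VI §1 for the finite Galois theory) — the subgroup of `Aut(ℂ)` fixing `⋂ᵢ Eᵢ` pointwise is GENERATED by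
the subgroups fixing the individual `Eᵢ`:

* `Complex.fixingSubgroup_iInf_eq_iSup` — `Aut(ℂ/⨅ᵢ Eᵢ) = ⨆ᵢ Aut(ℂ/Eᵢ)` for ANY nonempty family (no finiteness of the
  family and no normal closure is needed: `H := ⨆ᵢ Aut(ℂ/Eᵢ)` contains `Aut(ℂ/E_{i₀})`, hence is «closed»
  (`Complex.mem_subgroup_of_fix_fixedField`), and `Fix(H) ⊆ ⋂ᵢ Fix(Aut(ℂ/Eᵢ)) = ⋂ᵢ Eᵢ`);
* `Complex.fixingSubgroup_inf_eq_sup` — the two-field case `Aut(ℂ/(E₁ ⊓ E₂)) = Aut(ℂ/E₁) ⊔ Aut(ℂ/E₂)`;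
* `Complex.mem_iSup_fixingSubgroup_of_forall_mem_iInf` — membership form: an automorphism of `ℂ` fixing `⨅ᵢ Eᵢ`
  pointwise is a product of automorphisms each fixing some `Eᵢ` (and of their inverses).

Cell `hodgecm-mathlib` (D-0151), row I-6 (`descentToIntersection_printed` `_holds` programme, A-p08/A-p07 cut (Λ)/(D),
step (Λ4) GENERATION).  HC_CM is proved only modulo the 7 printed citations until rung 0 closes.

## References

* S. Lang, *Algebra*, rev. 3rd ed., GTM 211, Springer 2002, Ch. VI §1, Thm. 1.8 and Cor. 1.6 (the Galois correspondence
  exchanges intersections of subfields and joins of subgroups). [Lang2002]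
* P. Deligne, *Travaux de Shimura*, Sém. Bourbaki 389 (1971), Prop. 5.10. [Deligne1971]
-/

noncomputable section

open IntermediateField

namespace Literature.FieldTheory.AlgClosed

/-- Membership in an infimum of intermediate fields (Mathlib `IntermediateField.coe_iInf`, elementwise). [folklore] -/
private theorem IntermediateField.mem_iInf_iff {F L : Type*} [Field F] [Field L] [Algebra F L] {ι : Sort*}
    (E : ι → IntermediateField F L) {x : L} : x ∈ ⨅ i, E i ↔ ∀ i, x ∈ E i := by
  rw [← SetLike.mem_coe, IntermediateField.coe_iInf, Set.mem_iInter]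
  rfl

/-- **`Aut(ℂ/⨅ᵢ Eᵢ) = ⨆ᵢ Aut(ℂ/Eᵢ)`** for a nonempty family of subfields `Eᵢ ⊆ ℂ` finite over `ℚ`: the subgroup of
`Aut(ℂ) = (ℂ ≃ₐ[ℚ] ℂ)` fixing the intersection pointwise is generated by the subgroups fixing the members.  (`⨆ᵢ Aut(ℂ/Eᵢ)`
contains `Aut(ℂ/E_{i₀})`, so it contains every automorphism fixing its fixed field, `Complex.mem_subgroup_of_fix_fixedField`;
and that fixed field lies in every `Fix(Aut(ℂ/Eᵢ)) = Eᵢ`, `Complex.mem_of_forall_mem_fixingSubgroup`.)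
[cite: Lang2002, Ch. VI §1, Thm. 1.8 and Cor. 1.6] -/
theorem Complex.fixingSubgroup_iInf_eq_iSup {ι : Sort*} [Nonempty ι] (E : ι → IntermediateField ℚ ℂ)
    [∀ i, FiniteDimensional ℚ (E i)] :
    (⨅ i, E i).fixingSubgroup = ⨆ i, (E i).fixingSubgroup := by
  refine le_antisymm (fun σ hσ => ?_) (iSup_le fun i => ?_)
  · -- `H := ⨆ᵢ Aut(ℂ/Eᵢ)` contains `Aut(ℂ/E_{i₀})`
    obtain ⟨i₀⟩ := ‹Nonempty ι›
    refine Complex.mem_subgroup_of_fix_fixedField (⨆ i, (E i).fixingSubgroup) (E i₀).toSubfield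
      (fun τ hτ => ?_) (fun z hz => ?_)
    · exact (le_iSup (fun i => (E i).fixingSubgroup) i₀) ((mem_fixingSubgroup_iff _ _).mpr fun x hx => hτ x hx)
    · -- `z ∈ Fix(H)` lies in every `Eᵢ`, hence in `⨅ᵢ Eᵢ`, which `σ` fixes
      have hzE : z ∈ ⨅ i, E i := by
        rw [IntermediateField.mem_iInf_iff]
        intro i
        refine Complex.mem_of_forall_mem_fixingSubgroup (E i) fun τ hτ => ?_
        exact (mem_fixedField_iff _ z).mp hz τ (le_iSup (fun i => (E i).fixingSubgroup) i hτ)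
      exact (mem_fixingSubgroup_iff _ _).mp hσ z hzE
  · -- `Aut(ℂ/Eᵢ) ≤ Aut(ℂ/⨅ Eⱼ)` since `⨅ Eⱼ ≤ Eᵢ`
    intro σ hσ
    exact (mem_fixingSubgroup_iff _ _).mpr fun z hz =>
      (mem_fixingSubgroup_iff _ _).mp hσ z (((IntermediateField.mem_iInf_iff E).mp hz) i)

/-- **Two fields: `Aut(ℂ/(E₁ ⊓ E₂)) = Aut(ℂ/E₁) ⊔ Aut(ℂ/E₂)`** for `E₁, E₂ ⊆ ℂ` finite over `ℚ`.
[cite: Lang2002, Ch. VI §1, Thm. 1.8 and Cor. 1.6] -/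
theorem Complex.fixingSubgroup_inf_eq_sup (E₁ E₂ : IntermediateField ℚ ℂ) [FiniteDimensional ℚ E₁]
    [FiniteDimensional ℚ E₂] :
    (E₁ ⊓ E₂).fixingSubgroup = E₁.fixingSubgroup ⊔ E₂.fixingSubgroup := by
  refine le_antisymm (fun σ hσ => ?_) (sup_le ?_ ?_)
  · refine Complex.mem_subgroup_of_fix_fixedField (E₁.fixingSubgroup ⊔ E₂.fixingSubgroup) E₁.toSubfield
      (fun τ hτ => ?_) (fun z hz => ?_)
    · exact le_sup_left (b := E₂.fixingSubgroup) ((mem_fixingSubgroup_iff _ _).mpr fun x hx => hτ x hx)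
    · have hz₁ : z ∈ E₁ := Complex.mem_of_forall_mem_fixingSubgroup E₁ fun τ hτ =>
        (mem_fixedField_iff _ z).mp hz τ (le_sup_left (b := E₂.fixingSubgroup) hτ)
      have hz₂ : z ∈ E₂ := Complex.mem_of_forall_mem_fixingSubgroup E₂ fun τ hτ =>
        (mem_fixedField_iff _ z).mp hz τ (le_sup_right (a := E₁.fixingSubgroup) hτ)
      exact (mem_fixingSubgroup_iff _ _).mp hσ z (IntermediateField.mem_inf.mpr ⟨hz₁, hz₂⟩)
  · intro σ hσ
    exact (mem_fixingSubgroup_iff _ _).mpr fun z hz => (mem_fixingSubgroup_iff _ _).mp hσ z (IntermediateField.mem_inf.mp hz).1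
  · intro σ hσ
    exact (mem_fixingSubgroup_iff _ _).mpr fun z hz => (mem_fixingSubgroup_iff _ _).mp hσ z (IntermediateField.mem_inf.mp hz).2

/-- **Membership form**: an automorphism of `ℂ` fixing `⨅ᵢ Eᵢ` pointwise lies in the subgroup generated by the `Aut(ℂ/Eᵢ)`
(so it is a finite product of automorphisms each fixing some `Eᵢ` pointwise, and of inverses of such).
[cite: Lang2002, Ch. VI §1, Thm. 1.8 and Cor. 1.6] -/
theorem Complex.mem_iSup_fixingSubgroup_of_forall_mem_iInf {ι : Sort*} [Nonempty ι] (E : ι → IntermediateField ℚ ℂ)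
    [∀ i, FiniteDimensional ℚ (E i)] {σ : ℂ ≃ₐ[ℚ] ℂ} (hσ : ∀ z ∈ ⨅ i, E i, σ z = z) :
    σ ∈ ⨆ i, (E i).fixingSubgroup := by
  rw [← Complex.fixingSubgroup_iInf_eq_iSup]
  exact (mem_fixingSubgroup_iff _ _).mpr hσ

/-- **Induction form** (the shape in which «`λ(σ̃)` is defined for every `σ̃ ∈ Aut(ℂ/⋂ Eᵢ)` once it is defined on each
`Aut(ℂ/Eᵢ)` and is multiplicative» is used): a predicate on `Aut(ℂ)` that holds on every `Aut(ℂ/Eᵢ)`, at `1`, and is stable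
under products holds on all of `Aut(ℂ/⨅ᵢ Eᵢ)` (inverses come for free: each `Aut(ℂ/Eᵢ)` is a subgroup). [cite: Lang2002, Ch. VI §1, Thm. 1.8 and Cor. 1.6] -/
theorem Complex.induction_on_fixingSubgroup_iInf {ι : Sort*} [Nonempty ι] (E : ι → IntermediateField ℚ ℂ)
    [∀ i, FiniteDimensional ℚ (E i)] {p : (ℂ ≃ₐ[ℚ] ℂ) → Prop}
    (mem : ∀ i, ∀ τ ∈ (E i).fixingSubgroup, p τ) (one : p 1) (mul : ∀ τ₁ τ₂, p τ₁ → p τ₂ → p (τ₁ * τ₂))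
    {σ : ℂ ≃ₐ[ℚ] ℂ} (hσ : σ ∈ (⨅ i, E i).fixingSubgroup) : p σ := by
  rw [Complex.fixingSubgroup_iInf_eq_iSup] at hσ
  exact Subgroup.iSup_induction (fun i => (E i).fixingSubgroup) (C := p) hσ mem one mul

end Literature.FieldTheory.AlgClosed

end
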